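import Literature.MathematicalPhysics.QuantumFieldTheory.BalabanImbrieJaffe1984to88.BIJ88SmallCoupling23
import Literature.MathematicalPhysics.QuantumFieldTheory.BalabanImbrieJaffe1984to88.BIJ88Ineq5714Proof
import Literature.MathematicalPhysics.QuantumFieldTheory.BalabanImbrieJaffe1984to88.BIJ88Ineq579Second
import Literature.MathematicalPhysics.QuantumFieldTheory.BalabanImbrieJaffe1984to88.BIJ88GaussFactor309

/-!
# `BalabanImbrieJaffe1984to88.BIJ88SmallChargeRegime` — T. Bałaban, J. Imbrie, A. Jaffe, *Effective action and cluster properties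
of the abelian Higgs model*, Commun. Math. Phys. **114** (1988) 257–315 [BalabanImbrieJaffe1988]: the standing regime *"β > 0 small
and e ≪ 1"* (p. 273) / *"r(e_k) = |log e_k⁻¹|^r, r > 1"* ((2.3) p. 260) DISCHARGES the explicit e_k-smallness hypotheses under which
the Sect. 5.7 / 5.14 model instances of this folder were proved: there is a threshold δ > 0, depending only on the printed constants,
below which (5.7.14) (`BIJ88Ineq5714Proof.ineq5714_pieces`), the second inequality of (5.7.9) (`BIJ88Ineq579Second.ineq579_second`)
and the p. 309 Gaussian factor inequality (`BIJ88GaussFactor309.gauss309`) hold with NO regime hypothesis.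

statement-level skeleton of published theorems with citation tags; proofs where landed; nothing here is a claim about the Yang–Mills mass gap

MECHANISM.  log e_k⁻¹ → +∞ as e_k → 0⁺ (`BIJ88SmallCoupling23.tendsto_abs_log_inv`; Mathlib `Real.tendsto_log_atTop` ∘ `tendsto_inv_nhdsGT_zero`); every regime hypothesis is of one of the
shapes `K ≤ c (log e_k⁻¹)^s` (s > 0), `K e_k^τ ≤ 1` (τ > 0), `K e_k ≤ 1`, `r(e_k)^d ≤ e_k^{−θ}` (θ > 0), `e_k ≤ 1`, each of which
holds eventually in `𝓝[>] 0`; a finite conjunction of eventual statements is eventual, and an eventual statement at 0⁺ is a threshold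
statement (`exists_threshold`).

Contents (theorems only; no definitions, no `Prop` facts): `eventually_const_le_mul_log_rpow`,
`eventually_const_mul_le_one`, `eventually_const_mul_rpow_le_one`, `eventually_le_one`, `eventually_rLen_pow_le_rpow_neg`,
`exists_threshold`; the regime bundles `regime5714`, `regime579`, `regime309`; the discharged instances **`ineq5714_pieces_small`**,
**`ineq579_second_small`**, **`gauss309_small`**.

## References
* [BalabanImbrieJaffe1988] T. Bałaban, J. Imbrie, A. Jaffe, Commun. Math. Phys. 114 (1988) 257–315, (2.2)–(2.3) p. 260, (4.1) p. 273,
  (5.7.9) p. 291, (5.7.14) p. 295, p. 309.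
-/

open Filter Set
open scoped Topology

namespace Literature.MathematicalPhysics.QuantumFieldTheory.BalabanImbrieJaffe1984to88.BIJ88SmallChargeRegime

open Literature.MathematicalPhysics.QuantumFieldTheory.BalabanImbrieJaffe1984to88.BIJ88Sect2Statements (rLen eK pLog)
open Literature.MathematicalPhysics.QuantumFieldTheory.BalabanImbrieJaffe1984to88.BIJ88Sect5StatementsPart2
open Literature.MathematicalPhysics.QuantumFieldTheory.BalabanImbrieJaffe1984to88.BIJ88SmallCoupling23
open Literature.MathematicalPhysics.QuantumFieldTheory.BalabanImbrieJaffe1984to88.BIJ88ScaleSums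
open Literature.MathematicalPhysics.QuantumFieldTheory.BalabanImbrieJaffe1984to88.BIJ88Ineq5714Proof
open Literature.MathematicalPhysics.QuantumFieldTheory.BalabanImbrieJaffe1984to88.BIJ88Ineq579Second
open Literature.MathematicalPhysics.QuantumFieldTheory.BalabanImbrieJaffe1984to88.BIJ88GaussFactor309

/-! ## Eventual regime lemmas at e_k → 0⁺ -/

/-- Shape `K ≤ c (log e_k⁻¹)^s` (c > 0, s > 0) holds for e_k small — e.g. «κ ≤ c(log e_k⁻¹)^{r−1}», «log 2 ≤ c r (log e_k⁻¹)^{r−1}·((4−d)/2)log L»,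
«n + 1 ≤ c(log e_k⁻¹)^{2p−1}», «1 ≤ (c/2) r(e_k)». [cite: BalabanImbrieJaffe1988, (2.3) p.260] -/
theorem eventually_const_le_mul_log_rpow (K c s : ℝ) (hc : 0 < c) (hs : 0 < s) :
    ∀ᶠ x : ℝ in 𝓝[>] 0, K ≤ c * Real.log x⁻¹ ^ s :=
  -- log x⁻¹ → +∞ as x → 0⁺ (the tree's `Literature.Barriers.CriticalPhenomena.CTWSAW.tendsto_log_inv_nhdsGT`, inlined here to
  -- keep the import cone inside BIJ88): `Real.tendsto_log_atTop.comp tendsto_inv_nhdsGT_zero`.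
  (((tendsto_rpow_atTop hs).comp (Real.tendsto_log_atTop.comp tendsto_inv_nhdsGT_zero)).const_mul_atTop
    hc).eventually_ge_atTop K

/-- Shape `K e_k ≤ 1` holds for e_k small. [cite: BalabanImbrieJaffe1988, (2.2) p.260] -/
theorem eventually_const_mul_le_one (K : ℝ) : ∀ᶠ x : ℝ in 𝓝[>] 0, K * x ≤ 1 := by
  have h : Tendsto (fun x : ℝ => K * x) (𝓝 0) (𝓝 0) := by
    simpa using (continuous_const_mul K).tendsto (0 : ℝ)
  exact (h.mono_left nhdsWithin_le_nhds).eventually (eventually_le_nhds one_pos)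

/-- Shape `K e_k^τ ≤ 1` (τ > 0) holds for e_k small — e.g. «(2/(1 − L^{−(4−d)κ/2}) + 8) e_k^τ ≤ 1». [cite: BalabanImbrieJaffe1988, (2.2) p.260] -/
theorem eventually_const_mul_rpow_le_one (K τ : ℝ) (hτ : 0 < τ) : ∀ᶠ x : ℝ in 𝓝[>] 0, K * x ^ τ ≤ 1 := by
  have h1 : Tendsto (fun x : ℝ => x ^ τ) (𝓝 0) (𝓝 0) := by
    have := (Real.continuousAt_rpow_const 0 τ (Or.inr hτ.le)).tendsto
    simpa [Real.zero_rpow hτ.ne'] using this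
  have h2 : Tendsto (fun x : ℝ => K * x ^ τ) (𝓝 0) (𝓝 0) := by simpa using h1.const_mul K
  exact (h2.mono_left nhdsWithin_le_nhds).eventually (eventually_le_nhds one_pos)

/-- `e_k ≤ 1` for e_k small. [cite: BalabanImbrieJaffe1988, (2.2) p.260] -/
theorem eventually_le_one : ∀ᶠ x : ℝ in 𝓝[>] 0, x ≤ 1 := by
  simpa using eventually_const_mul_le_one 1

/-- Shape `r(e_k)^d ≤ e_k^{−θ}` (θ > 0) holds for e_k small: powers of the localization length are below any inverse power of the
charge («the high power of e_j beats the big factor (r(e_k)L^{k−j})^d», p. 291). [cite: BalabanImbrieJaffe1988, (5.7.9) p.291] -/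
theorem eventually_rLen_pow_le_rpow_neg (r θ : ℝ) (d : ℕ) (hθ : 0 < θ) :
    ∀ᶠ x : ℝ in 𝓝[>] 0, rLen r x ^ d ≤ x ^ (-θ) := by
  have hmem : ∀ᶠ x : ℝ in 𝓝[>] 0, x ∈ Ioo (0 : ℝ) 1 := Ioo_mem_nhdsGT one_pos
  filter_upwards [eventually_pLog_pow_le_exp_rLen 1 θ r 1 d hθ one_pos, hmem] with x hx hx01
  rw [one_mul] at hx
  have hpl : pLog r x = rLen r x := rfl
  rw [hpl] at hx
  refine hx.trans (le_of_eq ?_)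
  have hlog : 0 ≤ Real.log x⁻¹ := Real.log_nonneg ((one_le_inv₀ hx01.1).mpr hx01.2.le)
  unfold rLen
  rw [Real.rpow_one, abs_of_nonneg hlog, Real.log_inv, Real.rpow_def_of_pos hx01.1]
  ring_nf

/-- An eventual statement at 0⁺ is a threshold statement. [cite: BalabanImbrieJaffe1988, (2.2) p.260] -/
theorem exists_threshold {Q : ℝ → Prop} (h : ∀ᶠ x : ℝ in 𝓝[>] 0, Q x) : ∃ δ > 0, ∀ x, 0 < x → x < δ → Q x := by
  obtain ⟨δ, hδ, hQ⟩ := (nhdsGT_basis (0 : ℝ)).eventually_iff.mp h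
  exact ⟨δ, hδ, fun x hx0 hxδ => hQ ⟨hx0, hxδ⟩⟩

/-! ## The three regime bundles -/

/-- The regime of (5.7.14) (`ineq5714_pieces`): for L > 1, d < 4, r > 1, c > 0, κ > 0, τ > 0 there is δ > 0 with, for 0 < x < δ:
x ≤ 1, log 2 ≤ c r (log x⁻¹)^{r−1}((4−d)/2) log L, κ ≤ c (log x⁻¹)^{r−1}, (2/(1 − (L^{−(4−d)/2})^κ) + 8) x^τ ≤ 1.
[cite: BalabanImbrieJaffe1988, (5.7.14) p.295] -/
theorem regime5714 {L : ℝ} {d : ℕ} (hL : 1 < L) (hd : d < 4) {r c : ℝ} (κ τ : ℝ) (hr : 1 < r) (hc : 0 < c) (hτ : 0 < τ) :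
    ∃ δ > 0, ∀ x, 0 < x → x < δ →
      x ≤ 1 ∧ Real.log 2 ≤ c * r * Real.log x⁻¹ ^ (r - 1) * ((4 - (d : ℝ)) / 2 * Real.log L) ∧
        κ ≤ c * Real.log x⁻¹ ^ (r - 1) ∧ (2 / (1 - (L ^ (-((4 - (d : ℝ)) / 2))) ^ κ) + 8) * x ^ τ ≤ 1 := by
  have hd' : (d : ℝ) < 4 := by exact_mod_cast hd
  have hlogL : 0 < (4 - (d : ℝ)) / 2 * Real.log L := mul_pos (by linarith) (Real.log_pos hL)
  have hcr : 0 < c * r * ((4 - (d : ℝ)) / 2 * Real.log L) := by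
    have : 0 < c * r := mul_pos hc (by linarith)
    positivity
  apply exists_threshold
  filter_upwards [eventually_le_one, eventually_const_le_mul_log_rpow (Real.log 2) _ (r - 1) hcr (by linarith),
    eventually_const_le_mul_log_rpow κ c (r - 1) hc (by linarith),
    eventually_const_mul_rpow_le_one (2 / (1 - (L ^ (-((4 - (d : ℝ)) / 2))) ^ κ) + 8) τ hτ] with x h1 h2 h3 h4
  refine ⟨h1, ?_, h3, h4⟩
  calc Real.log 2 ≤ c * r * ((4 - (d : ℝ)) / 2 * Real.log L) * Real.log x⁻¹ ^ (r - 1) := h2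
    _ = c * r * Real.log x⁻¹ ^ (r - 1) * ((4 - (d : ℝ)) / 2 * Real.log L) := by ring

/-- The regime of the second inequality of (5.7.9) (`ineq579_second`): for r > 0, c > 0, θ > 0 there is δ > 0 with, for 0 < x < δ:
x ≤ 1, 1 ≤ (c/2) r(x), r(x)^d ≤ x^{−θ}. [cite: BalabanImbrieJaffe1988, (5.7.9) p.291] -/
theorem regime579 {r c : ℝ} (θ : ℝ) (d : ℕ) (hr : 0 < r) (hc : 0 < c) (hθ : 0 < θ) :
    ∃ δ > 0, ∀ x, 0 < x → x < δ → x ≤ 1 ∧ 1 ≤ c / 2 * rLen r x ∧ rLen r x ^ d ≤ x ^ (-θ) := by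
  apply exists_threshold
  filter_upwards [eventually_le_one, eventually_const_le_mul_log_rpow 1 (c / 2) r (by positivity) hr,
    eventually_rLen_pow_le_rpow_neg r θ d hθ, Ioo_mem_nhdsGT one_pos] with x h1 h2 h3 hx01
  refine ⟨h1, ?_, h3⟩
  have hlog : 0 ≤ Real.log x⁻¹ := Real.log_nonneg ((one_le_inv₀ hx01.1).mpr hx01.2.le)
  unfold rLen
  rwa [abs_of_nonneg hlog]

/-- The regime of the p. 309 factor inequality (`gauss309`): for c > 0, p > ½, c′ there is δ > 0 with, for 0 < x < δ:
n + 1 ≤ c (log x⁻¹)^{2p−1} and c′x ≤ 1. [cite: BalabanImbrieJaffe1988, p.309 (Sect. 5.14)] -/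
theorem regime309 {c p : ℝ} (c' : ℝ) (n : ℕ) (hc : 0 < c) (hp : 1 / 2 < p) :
    ∃ δ > 0, ∀ x, 0 < x → x < δ → ((n : ℝ) + 1 ≤ c * Real.log x⁻¹ ^ (2 * p - 1)) ∧ c' * x ≤ 1 := by
  apply exists_threshold
  filter_upwards [eventually_const_le_mul_log_rpow ((n : ℝ) + 1) c (2 * p - 1) hc (by linarith),
    eventually_const_mul_le_one c'] with x h1 h2
  exact ⟨h1, h2⟩

/-! ## The discharged instances -/

/-- **(5.7.14) for e ≪ 1.**  `ineq5714_pieces` with its four e_k-smallness hypotheses replaced by `e_k < δ`, δ > 0 depending only on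
L, d, r, c, κ, τ. [cite: BalabanImbrieJaffe1988, (5.7.14) p.295] -/
theorem ineq5714_pieces_small (P : PolymerSys) (hcard : ∀ X, 1 ≤ P.card X) {L ε e₀ : ℝ} {d : ℕ} (hL : 1 < L) (hε : 0 < ε)
    (he₀ : 0 < e₀) (hd : d < 4) {r c κ α τ : ℝ} (hr : 1 < r) (hc : 0 < c) (hκ : 0 < κ) (hτ : 0 < τ) :
    ∃ δ > 0, ∀ (k : ℕ), eK L ε e₀ d k < δ →
      ∀ (W₁ W₂ W₃ W₄ W₅ W₆ : ℕ → P.Poly → ℝ) (vol₂ vol₆ lfVol : ℕ → P.Poly → ℕ),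
      (∀ j X, vol₂ j X ≤ lfVol j X) → (∀ j X, vol₆ j X ≤ lfVol j X) →
      (∀ j, j ≤ k → ∀ X, |W₁ j X| ≤
        eK L ε e₀ d j ^ κ * Real.exp (-(c * rLen r (eK L ε e₀ d k)) * P.cardMinus X)) →
      (∀ j, j < k → ∀ X, |W₂ j X| ≤
        eK L ε e₀ d j ^ (1 - α) * Real.exp (-(c * rLen r (eK L ε e₀ d k)) * P.card X) * vol₂ j X) →
      (∀ X, |W₂ k X| ≤ eK L ε e₀ d k ^ κ * Real.exp (-(c * rLen r (eK L ε e₀ d k)) * P.cardMinus X)) →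
      (∀ j, j ≤ k → ∀ X, |W₃ j X| ≤ Real.exp (-(c * rLen r (eK L ε e₀ d j)) * P.card X)) →
      (∀ j, j ≤ k → ∀ X, |W₄ j X| ≤ Real.exp (-(c * rLen r (eK L ε e₀ d j)) * P.card X)) →
      (∀ j, j ≤ k → ∀ X, |W₅ j X| ≤ Real.exp (-(c * rLen r (eK L ε e₀ d j)) * P.card X)) →
      (∀ j, j < k → ∀ X, |W₆ j X| ≤
        eK L ε e₀ d j ^ (1 - α) * Real.exp (-(c * rLen r (eK L ε e₀ d k)) * P.card X) * vol₆ j X) →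
      (∀ X, |W₆ k X| ≤ Real.exp (-(c * rLen r (eK L ε e₀ d k)) * P.card X)) →
      ∀ (W : P.Poly → ℝ),
      (∀ X, W X = ∑ j ∈ Finset.range (k + 1), (W₁ j X + W₂ j X + W₃ j X + W₄ j X + W₅ j X + W₆ j X)) →
      Ineq5714 P W k (fun j => eK L ε e₀ d j) lfVol (κ - τ) (α + τ) c (rLen r (eK L ε e₀ d k)) := by
  obtain ⟨δ, hδ, hreg⟩ := regime5714 hL hd κ τ hr hc hτ
  refine ⟨δ, hδ, fun k hk W₁ W₂ W₃ W₄ W₅ W₆ vol₂ vol₆ lfVol hvol₂ hvol₆ h1 h2 h2k h3 h4 h5 h6 h6k W hW => ?_⟩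
  have hL0 : 0 < L := by linarith
  obtain ⟨hek1, hg, hκR, hAτ⟩ := hreg _ (eK_pos hL0 hε he₀ k) hk
  exact ineq5714_pieces P hcard hL hε he₀ hd k hek1 hr hc hκ hτ W₁ W₂ W₃ W₄ W₅ W₆ vol₂ vol₆ lfVol hvol₂ hvol₆ h1 h2 h2k
    h3 h4 h5 h6 h6k W hW hg hκR hAτ

/-- **(5.7.9), second inequality, for e ≪ 1.**  `ineq579_second` with its three e_k-smallness hypotheses replaced by `e_k < δ`,
δ > 0 depending only on r, c, θ, d. [cite: BalabanImbrieJaffe1988, (5.7.9) p.291] -/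
theorem ineq579_second_small (P : PolymerSys) {L ε e₀ : ℝ} {d : ℕ} (hL : 1 < L) (hε : 0 < ε) (he₀ : 0 < e₀) (hd : d < 4)
    {r c θ : ℝ} (α : ℝ) (nbar : ℕ) (hr : 0 < r) (hc : 0 < c) (hθ : 0 < θ) :
    ∃ δ > 0, ∀ {j k : ℕ}, j ≤ k → eK L ε e₀ d k < δ → ∀ {X : P.Poly}, 1 ≤ P.card X →
      eK L ε e₀ d j ^ ((nbar : ℝ) + 1 - α) * Real.exp (-(c * rLen r (eK L ε e₀ d k)) * P.cardMinus X) *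
          (rLen r (eK L ε e₀ d k) * L ^ (k - j)) ^ d * P.card X ≤
        eK L ε e₀ d j ^ ((nbar : ℝ) + 1 - α - 2 * (d : ℝ) / (4 - (d : ℝ)) - θ) *
          Real.exp (-(c / 2 * rLen r (eK L ε e₀ d k)) * P.cardMinus X) := by
  obtain ⟨δ, hδ, hreg⟩ := regime579 θ d hr hc hθ
  refine ⟨δ, hδ, fun {j k} hj hk {X} hX => ?_⟩
  have hL0 : 0 < L := by linarith
  obtain ⟨hek1, hc2, hpoly⟩ := hreg _ (eK_pos hL0 hε he₀ k) hk
  exact ineq579_second P hL hε he₀ hd hj hek1 hθ hc2 hpoly hX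

/-- **p. 309 factor inequality for e ≪ 1.**  `gauss309` with its two e_k-smallness hypotheses replaced by `e_k < δ`, δ > 0 depending
only on c, c′, p, n. [cite: BalabanImbrieJaffe1988, p.309 (Sect. 5.14)] -/
theorem gauss309_small {c c' p : ℝ} {n : ℕ} (hc : 0 < c) (hc' : 0 ≤ c') (hp : 1 / 2 < p) :
    ∃ δ > 0, ∀ {L ε e s ε₀ t α β : ℝ} {d k : ℕ}, 0 < L → 0 < ε → 0 < e → e ≤ 1 → β ≤ 1 → 0 ≤ α → d < 4 →
      0 < s → s ≤ 1 → 0 < ε₀ → ε₀ ≤ 1 → L ^ k * ε = s * ε₀ → 0 < t → t ≤ 1 → eK L ε e d k < δ →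
      c' / t ^ n * Real.exp (-(c * pLog p (t * eK L ε e d k) ^ 2)) ≤ (e ^ β * s ^ (1 / 4 - α)) ^ n := by
  obtain ⟨δ, hδ, hreg⟩ := regime309 c' n hc hp
  refine ⟨δ, hδ, ?_⟩
  intro L ε e s ε₀ t α β d k hL hε he0 he1 hβ1 hα hd hs0 hs1 hε₀0 hε₀1 hLε ht0 ht1 hk
  obtain ⟨hr, hsm⟩ := hreg _ (eK_pos hL hε he0 k) hk
  exact gauss309 hL hε he0 he1 hβ1 hα hd hs0 hs1 hε₀0 hε₀1 hLε ht0 ht1 hp hc.le hc' hr hsm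

end Literature.MathematicalPhysics.QuantumFieldTheory.BalabanImbrieJaffe1984to88.BIJ88SmallChargeRegime
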